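import Mathlib
import HarnessLib
import Literature.Dynamics.Homogeneous.HorocycleFlowFrameStrip
import Literature.NumberTheory.LFunctions.HorocycleUnfolding

/-!
# Unfolding the closed horocycle on the modular frame bundle `SL(2,ℤ)\SL(2,ℝ)`

Support file (everything PROVED; no definitions, no named facts) for the proof of
`Literature.Dynamics.Homogeneous.flaminioForni_closedHorocycle_modular` (`HorocycleFlow.lean`;
Flaminio–Forni, Duke Math. J. 119 (2003), Prop. 5.15), continuing `HorocycleFlowFrameStrip.lean`
(frame coordinates `frameOf`, the profile `frameProfile f`, the cells `frameCell f y v`, the class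
`IsFrameStripFun` and the arc transform `frameArcTransform`).  It is the frame-bundle version of
the tree's `HorocycleRateHalfUnfolding.lean` + `HorocycleUnfolding.lean` (surface case), whose
arithmetic lemmas it reuses.

Main results, for a test function `f` on `SL(2,ℤ)\SL(2,ℝ)` (`IsModularFrameTestFunction f`):
* `IsModularFrameTestFunction.isFrameStripFun_frameProfile` — the profile
  `p(x,c,d) = f(n(x)s(c,d)) χ₀(1/r²)/E₀(x + i/r²)` is a frame strip test function: smooth on `ℝ³`
  (a quotient of smooth functions away from `(c,d) = 0`, identically `0` on the disc
  `r² < 1/Y_f` since `f` vanishes at frames of height `> Y_f = max Y 1`, `apply_eq_zero_of_lt_im`),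
  `1`-periodic (`frameOf (x+1) c d = T · frameOf x c d`), `= 0` for `r² ≥ 2` (`χ₀ = 0` below `1/2`);
* `IsModularFrameTestFunction.frameUnfolding` — for `0 < y < 1/2` and `N ≥ √(2/y)`,
  `∫₀¹ f(n(x)a(y)) dx = 2y ∑_{c=1}^{N} ∑_{a mod c, (a,c)=1} Ψ_p(c²y, a/c)`.
  Steps: partition of unity `f(g) = ∑_{(c,d)=1} f(g) χ₀,(c,d)(g·i)/E₀(g·i)` (`E₀ = ∑ χ₀,v ≥ 1`,
  tree); on the segment only the pairs of a box contribute (tree box lemma); the row `c = 0`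
  vanishes (`χ₀(y) = 0`), rows `±c` agree; along a row `cell_{(c,cq+r)}(u) = cell_{(c,r)}(u+q)`
  (invariance of `f` and `E₀` under `T^q`), so the `q`-sum tiles `ℝ`; the CELL IDENTITY
  `f(g) χ₀,v(g·i)/E₀(g·i) = p(coords(γ_v g))` (`γ_v g = n(x') s(c',d')`,
  `IsModularFrameTestFunction.cell_eq_frameProfile`) and the explicit product
  `γ n(u) a(y) = (A√y, (Au+B)/√y; c√y, (cu+r)/√y)` turn the row integral, after `u = yt - r/c`,
  into `y Ψ_p(c²y, r̄/c)` (`integral_frameCell_eq`); finally `r ↦ r̄ = r⁻¹ (mod c)` permutes the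
  reduced residues (tree `sum_coprime_gcdA_eq`) and the rows `c > N` vanish (`c²y > 2`).

## References
* H. Iwaniec, *Spectral Methods of Automorphic Forms*, 2nd ed., AMS GSM 53 (2002), §2.4
  Thm. 2.7 (2.21), §3.4 [Iwaniec2002].
* L. Flaminio, G. Forni, *Invariant distributions and time averages for horocycle flows*, Duke
  Math. J. 119 (2003) 465–526, Prop. 5.15 [FlaminioForni2003].
* P. Sarnak, *Asymptotic behavior of periodic orbits of the horocycle flow and Eisenstein series*,
  Comm. Pure Appl. Math. 34 (1981) 719–739, Thm. 1 [Sarnak1981].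

## Mathlib / tree search
Mathlib: `UpperHalfPlane.coe_specialLinearGroup_apply`, `UpperHalfPlane.modular_T_zpow_smul`,
`ModularGroup.coe_T_zpow`, `Matrix.SpecialLinearGroup.coe_matrix_coe`,
`Measure.integral_comp_mul_left`, `integral_sub_right_eq_self`.  Tree: `incEis_smul`,
`contDiffOn_incEis_cuspCutoff`, `one_le_incEis_cuspCutoff`/`incEis_cuspCutoff_ne_zero`,
`incEisTerm_eq_zero_of_not_mem_pairBox`, `sq_le_of_incEisTerm_ne_zero`, `coe_T_zpow_smul`,
`HorocycleUnfolding.{gcdA_mul_add_gcdB_mul, im_smul_eq, sum_pairBox_eq', sum_Icc_symm',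
sum_integral_unit_intervals', sum_coprime_gcdA_eq}`, `HorocycleZeroMode.sum_Ioc_zero_eq_sum_range`,
`Literature.MeasureTheory.Group.{xOf, yOf, coe_smul_I_eq}` (`SL2IwasawaHaar.lean`).
-/

noncomputable section

open Complex MeasureTheory Set Filter Topology intervalIntegral
open scoped Real ContDiff MatrixGroups
open Literature.NumberTheory.LFunctions Literature.NumberTheory.LFunctions.HorocycleStripFourier

namespace Literature.Dynamics.Homogeneous

open Literature.MeasureTheory.Group (xOf yOf coe_smul_I_eq)

section TestFunction

variable {f : SL(2, ℝ) → ℂ}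

/-! ### The two actions of `SL(2,ℤ)` and translations of frames -/

/-- The action of `γ ∈ SL(2,ℤ)` on `ℍ` through `SL(2,ℝ)` is its own action. [folklore] -/
theorem coe_int_smul (γ : SL(2, ℤ)) (z : UpperHalfPlane) : ((γ : SL(2, ℝ)) • z) = γ • z := by
  apply UpperHalfPlane.ext
  rw [UpperHalfPlane.coe_specialLinearGroup_apply, UpperHalfPlane.coe_specialLinearGroup_apply]
  simp

/-- `(γ g) • i = γ • (g • i)`. [folklore] -/
theorem coe_int_mul_smul (γ : SL(2, ℤ)) (g : SL(2, ℝ)) (z : UpperHalfPlane) :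
    ((γ : SL(2, ℝ)) * g) • z = γ • (g • z) := by
  rw [mul_smul, coe_int_smul]

/-- Integer translation of the horocycle frame: `n(u+m) a(y) = T^m · n(u) a(y)`. [folklore] -/
theorem modularHorocycleFrame_add_int {y : ℝ} (hy : 0 < y) (u : ℝ) (m : ℤ) :
    modularHorocycleFrame (u + m) y =
      ((ModularGroup.T ^ m : SL(2, ℤ)) : SL(2, ℝ)) * modularHorocycleFrame u y := by
  ext i j
  rw [Matrix.SpecialLinearGroup.coe_mul, modularHorocycleFrame_coe hy, modularHorocycleFrame_coe hy,
    Matrix.SpecialLinearGroup.coe_matrix_coe, ModularGroup.coe_T_zpow]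
  have hs : Real.sqrt y ≠ 0 := (Real.sqrt_pos.2 hy).ne'
  fin_cases i <;> fin_cases j <;> simp [Matrix.mul_apply, Fin.sum_univ_two]
  field_simp

/-- Left invariance under integer translations: `f(n(u+m) a(y)) = f(n(u) a(y))`. [folklore] -/
theorem IsModularFrameTestFunction.apply_frame_add_int (hf : IsModularFrameTestFunction f) {y : ℝ}
    (hy : 0 < y) (u : ℝ) (m : ℤ) :
    f (modularHorocycleFrame (u + m) y) = f (modularHorocycleFrame u y) := by
  rw [modularHorocycleFrame_add_int hy, hf.2.1]

/-- **A `Γ`-invariant cusp-supported `f` vanishes at every frame of height `> max Y 1`**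
(translate the base point into `𝒟` by a power of `T`). [folklore] -/
theorem apply_eq_zero_of_lt_im (hinv : ∀ (γ : SL(2, ℤ)) (g : SL(2, ℝ)), f ((γ : SL(2, ℝ)) * g) = f g)
    {Y : ℝ} (hY : ∀ g : SL(2, ℝ), g • UpperHalfPlane.I ∈ ModularGroup.fd →
      Y < (g • UpperHalfPlane.I).im → f g = 0)
    {g : SL(2, ℝ)} (hg : max Y 1 < (g • UpperHalfPlane.I).im) : f g = 0 := by
  set z : UpperHalfPlane := g • UpperHalfPlane.I with hz
  set n : ℤ := round z.re with hn
  set g' : SL(2, ℝ) := ((ModularGroup.T ^ (-n) : SL(2, ℤ)) : SL(2, ℝ)) * g with hg'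
  have hz' : g' • UpperHalfPlane.I = ModularGroup.T ^ (-n) • z := by
    rw [hg', coe_int_mul_smul]
  have hwim : (g' • UpperHalfPlane.I).im = z.im := by
    rw [hz', UpperHalfPlane.modular_T_zpow_smul, UpperHalfPlane.vadd_im]
  have hwre : (g' • UpperHalfPlane.I).re = z.re - n := by
    rw [hz', UpperHalfPlane.modular_T_zpow_smul, UpperHalfPlane.vadd_re]; push_cast; ring
  have hfd : g' • UpperHalfPlane.I ∈ ModularGroup.fd := by
    constructor
    · rw [Complex.normSq_apply, UpperHalfPlane.coe_re, UpperHalfPlane.coe_im, hwim]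
      have : 1 < z.im := lt_of_le_of_lt (le_max_right _ _) hg
      nlinarith [sq_nonneg (g' • UpperHalfPlane.I).re]
    · rw [hwre, hn]; exact abs_sub_round z.re
  have h1 : f g' = 0 := hY g' hfd (by rw [hwim]; exact lt_of_le_of_lt (le_max_left _ _) hg)
  rwa [hg', hinv] at h1

/-- The test-function version of `apply_eq_zero_of_lt_im`, with the cusp parameter chosen once
and for all: `Y_f = max Y 1 ≥ 1`. [folklore] -/
theorem IsModularFrameTestFunction.exists_cusp (hf : IsModularFrameTestFunction f) :
    ∃ Y₁ : ℝ, 1 ≤ Y₁ ∧ ∀ g : SL(2, ℝ), Y₁ < (g • UpperHalfPlane.I).im → f g = 0 := by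
  obtain ⟨Y, hY⟩ := hf.2.2
  exact ⟨max Y 1, le_max_right _ _, fun g hg => apply_eq_zero_of_lt_im hf.2.1 hY hg⟩

/-! ### The profile of a test function is a frame strip test function -/

/-- Height of `frameOf x c d`: `1/(c² + d²)`. [folklore] -/
theorem im_frameOf_smul_I {x c d : ℝ} (h : c ^ 2 + d ^ 2 ≠ 0) :
    (frameOf x c d • UpperHalfPlane.I).im = 1 / (c ^ 2 + d ^ 2) := by
  rw [← UpperHalfPlane.coe_im, coe_frameOf_smul_I h]

/-- The profile vanishes near the singular set `(c,d) = 0` (heights above the support of `f`, or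
the junk value at `r = 0` where `χ₀(1/0) = χ₀(0) = 0`). [folklore] -/
theorem frameProfile_eq_zero_of_lt {Y₁ : ℝ} (hY₁ : 1 ≤ Y₁)
    (hfY : ∀ g : SL(2, ℝ), Y₁ < (g • UpperHalfPlane.I).im → f g = 0) {x c d : ℝ}
    (h : c ^ 2 + d ^ 2 < 1 / Y₁) : frameProfile f (x, c, d) = 0 := by
  rw [frameProfile_apply]
  rcases eq_or_ne (c ^ 2 + d ^ 2) 0 with h0 | h0
  · rw [h0, div_zero, cuspCutoff_of_le (by norm_num)]; simp
  · have hpos : 0 < c ^ 2 + d ^ 2 := lt_of_le_of_ne (by positivity) (Ne.symm h0)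
    have hY0 : 0 < Y₁ := by linarith
    have : f (frameOf x c d) = 0 := by
      apply hfY
      rw [im_frameOf_smul_I h0, lt_div_iff₀ hpos]
      rw [lt_div_iff₀ hY0] at h
      linarith [mul_comm Y₁ (c ^ 2 + d ^ 2)]
    rw [this]; simp

/-- The profile vanishes for `c² + d² ≥ 2` (heights `≤ 1/2`, where `χ₀ = 0`). [folklore] -/
theorem frameProfile_eq_zero_of_two_le (f : SL(2, ℝ) → ℂ) {x c d : ℝ} (h : 2 ≤ c ^ 2 + d ^ 2) :
    frameProfile f (x, c, d) = 0 := by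
  rw [frameProfile_apply]
  have hpos : 0 < c ^ 2 + d ^ 2 := by linarith
  have : cuspCutoff (1 / (c ^ 2 + d ^ 2)) = 0 := by
    apply cuspCutoff_of_le
    rw [div_le_div_iff₀ hpos two_pos]; linarith
  rw [this]; simp

/-- Periodicity of `E₀` in the real direction at height `h > 0`. [folklore] -/
theorem incEis_cuspCutoff_add_one {x h : ℝ} (hh : 0 < h) :
    incEis cuspCutoff ⟨x + 1, h⟩ = incEis cuspCutoff ⟨x, h⟩ := by
  have hz : 0 < (⟨x, h⟩ : ℂ).im := hh
  have := incEis_smul cuspCutoff ModularGroup.T ⟨⟨x, h⟩, hz⟩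
  rw [coe_T_smul] at this
  convert this using 2
  apply Complex.ext <;> simp

/-- **`1`-periodicity of the profile** (`frameOf (x+1) c d = T · frameOf x c d`, invariance of
`f` and of `E₀` under `T`). [folklore] -/
theorem frameProfile_add_one (hf : IsModularFrameTestFunction f) (x c d : ℝ) :
    frameProfile f (x + 1, c, d) = frameProfile f (x, c, d) := by
  rw [frameProfile_apply, frameProfile_apply]
  rcases eq_or_ne (c ^ 2 + d ^ 2) 0 with h0 | h0
  · rw [h0, div_zero, cuspCutoff_of_le (by norm_num)]; simp
  · have hpos : 0 < c ^ 2 + d ^ 2 := lt_of_le_of_ne (by positivity) (Ne.symm h0)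
    rw [frameOf_add_one h0, hf.2.1, incEis_cuspCutoff_add_one (one_div_pos.2 hpos)]

/-- The explicit entries of `frameOf` as a map `ℝ³ → ℝ^{2×2}`. [folklore] -/
theorem frameOf_entries_eq {q : ℝ × ℝ × ℝ} (h : q.2.1 ^ 2 + q.2.2 ^ 2 ≠ 0) :
    Matrix.of.symm ((frameOf q.1 q.2.1 q.2.2 : SL(2, ℝ)) : Matrix (Fin 2) (Fin 2) ℝ) =
      ![![q.2.2 / (q.2.1 ^ 2 + q.2.2 ^ 2) + q.1 * q.2.1, -q.2.1 / (q.2.1 ^ 2 + q.2.2 ^ 2) + q.1 * q.2.2],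
        ![q.2.1, q.2.2]] := by
  rw [frameOf_coe h]; rfl

/-- Smoothness of the entry map away from `(c,d) = 0`. [folklore] -/
theorem contDiffOn_entries :
    ContDiffOn ℝ ∞ (fun q : ℝ × ℝ × ℝ =>
      (![![q.2.2 / (q.2.1 ^ 2 + q.2.2 ^ 2) + q.1 * q.2.1, -q.2.1 / (q.2.1 ^ 2 + q.2.2 ^ 2) + q.1 * q.2.2],
        ![q.2.1, q.2.2]] : Fin 2 → Fin 2 → ℝ))
      {q : ℝ × ℝ × ℝ | q.2.1 ^ 2 + q.2.2 ^ 2 ≠ 0} := by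
  refine contDiffOn_pi.2 fun i => contDiffOn_pi.2 fun j => ?_
  fin_cases i <;> fin_cases j
  · simp only [Fin.zero_eta, Matrix.cons_val_zero]
    exact ((contDiffOn_snd.snd).div (by fun_prop) fun q hq => hq).add (by fun_prop)
  · simp only [Fin.zero_eta, Fin.mk_one, Matrix.cons_val_zero, Matrix.cons_val_one,
      Matrix.cons_val_fin_one]
    exact ((contDiffOn_snd.fst.neg).div (by fun_prop) fun q hq => hq).add (by fun_prop)
  · simp only [Fin.mk_one, Fin.zero_eta, Matrix.cons_val_one, Matrix.cons_val_fin_one,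
      Matrix.cons_val_zero]
    fun_prop
  · simp only [Fin.mk_one, Matrix.cons_val_one, Matrix.cons_val_fin_one]
    fun_prop

/-- Smoothness of `q ↦ f (frameOf q)` away from `(c,d) = 0`. [folklore] -/
theorem contDiffOn_apply_frameOf (hf : IsModularFrameTestFunction f) :
    ContDiffOn ℝ ∞ (fun q : ℝ × ℝ × ℝ => f (frameOf q.1 q.2.1 q.2.2))
      {q : ℝ × ℝ × ℝ | q.2.1 ^ 2 + q.2.2 ^ 2 ≠ 0} := by
  obtain ⟨F, hF, hfF⟩ := hf.1
  refine ((hF.comp_contDiffOn contDiffOn_entries)).congr fun q hq => ?_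
  rw [hfF, frameOf_entries_eq hq]
  rfl

/-- Smoothness of `q ↦ E₀(x + i/r²)` and nonvanishing, away from `(c,d) = 0`. [folklore] -/
theorem contDiffOn_incEis_comp :
    ContDiffOn ℝ ∞ (fun q : ℝ × ℝ × ℝ => incEis cuspCutoff ⟨q.1, 1 / (q.2.1 ^ 2 + q.2.2 ^ 2)⟩)
      {q : ℝ × ℝ × ℝ | q.2.1 ^ 2 + q.2.2 ^ 2 ≠ 0} := by
  have hΦ : ContDiffOn ℝ ∞ (fun q : ℝ × ℝ × ℝ =>
      (q.1 : ℂ) + ((1 / (q.2.1 ^ 2 + q.2.2 ^ 2) : ℝ) : ℂ) * I) {q : ℝ × ℝ × ℝ | q.2.1 ^ 2 + q.2.2 ^ 2 ≠ 0} := by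
    refine ((Complex.ofRealCLM.contDiff.comp contDiff_fst).contDiffOn).add ?_
    refine ContDiffOn.mul ?_ contDiffOn_const
    exact Complex.ofRealCLM.contDiff.comp_contDiffOn (contDiffOn_const.div (by fun_prop) fun q hq => hq)
  have hmaps : Set.MapsTo (fun q : ℝ × ℝ × ℝ => (q.1 : ℂ) + ((1 / (q.2.1 ^ 2 + q.2.2 ^ 2) : ℝ) : ℂ) * I)
      {q : ℝ × ℝ × ℝ | q.2.1 ^ 2 + q.2.2 ^ 2 ≠ 0} {z : ℂ | 0 < z.im} := by
    intro q hq
    have hpos : 0 < q.2.1 ^ 2 + q.2.2 ^ 2 := lt_of_le_of_ne (by positivity) (Ne.symm hq)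
    simp only [Set.mem_setOf_eq, add_im, ofReal_im, mul_im, ofReal_re, I_im, mul_one, I_re,
      mul_zero, add_zero, zero_add]
    positivity
  have h := contDiffOn_incEis_cuspCutoff.comp hΦ hmaps
  refine h.congr fun q _ => ?_
  simp only [Function.comp_apply, Complex.mk_eq_add_mul_I]

/-- **Smoothness of the profile** on all of `ℝ³`: it is a quotient of smooth functions away from
`(c,d) = 0` and vanishes identically on the disc `c² + d² < 1/Y_f`. [folklore] -/
theorem contDiff_frameProfile (hf : IsModularFrameTestFunction f) : ContDiff ℝ ∞ (frameProfile f) := by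
  obtain ⟨Y₁, hY₁, hfY⟩ := hf.exists_cusp
  have hY0 : 0 < 1 / Y₁ := by positivity
  set U : Set (ℝ × ℝ × ℝ) := {q | q.2.1 ^ 2 + q.2.2 ^ 2 ≠ 0} with hU
  have hUo : IsOpen U := isOpen_ne_fun (by fun_prop) continuous_const
  -- smoothness on `U`
  have hχ : ContDiffOn ℝ ∞ (fun q : ℝ × ℝ × ℝ => (cuspCutoff (1 / (q.2.1 ^ 2 + q.2.2 ^ 2)) : ℂ)) U :=
    Complex.ofRealCLM.contDiff.comp_contDiffOn
      (contDiff_cuspCutoff.comp_contDiffOn (contDiffOn_const.div (by fun_prop) fun q hq => hq))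
  have hE0 : ∀ q ∈ U, incEis cuspCutoff ⟨q.1, 1 / (q.2.1 ^ 2 + q.2.2 ^ 2)⟩ ≠ 0 := by
    intro q hq
    apply incEis_cuspCutoff_ne_zero
    have hpos : 0 < q.2.1 ^ 2 + q.2.2 ^ 2 := lt_of_le_of_ne (by positivity) (Ne.symm hq)
    change 0 < 1 / (q.2.1 ^ 2 + q.2.2 ^ 2)
    positivity
  have hUs : ContDiffOn ℝ ∞ (frameProfile f) U := by
    have h := ((contDiffOn_apply_frameOf hf).mul hχ).mul (contDiffOn_incEis_comp.inv hE0)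
    refine h.congr fun q _ => ?_
    obtain ⟨x, c, d⟩ := q
    simp only [frameProfile, div_eq_mul_inv, Pi.inv_apply]
  refine contDiff_iff_contDiffAt.2 fun q => ?_
  by_cases hq : q.2.1 ^ 2 + q.2.2 ^ 2 < 1 / Y₁
  · -- vanishes identically near `q`
    have hV : {q' : ℝ × ℝ × ℝ | q'.2.1 ^ 2 + q'.2.2 ^ 2 < 1 / Y₁} ∈ 𝓝 q :=
      (isOpen_lt (by fun_prop) continuous_const).mem_nhds hq
    refine (contDiffAt_const (c := (0:ℂ))).congr_of_eventuallyEq ?_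
    filter_upwards [hV] with q' hq'
    obtain ⟨x, c, d⟩ := q'
    exact frameProfile_eq_zero_of_lt hY₁ hfY hq'
  · have hqU : q ∈ U := by
      intro h0
      change q.2.1 ^ 2 + q.2.2 ^ 2 = 0 at h0
      rw [h0] at hq; exact hq hY0
    exact hUs.contDiffAt (hUo.mem_nhds hqU)

/-- **The profile of a test function on `SL(2,ℤ)\SL(2,ℝ)` is a frame strip test function.**
[folklore] -/
theorem IsModularFrameTestFunction.isFrameStripFun_frameProfile (hf : IsModularFrameTestFunction f) :
    IsFrameStripFun (frameProfile f) where
  smooth := contDiff_frameProfile hf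
  periodic := frameProfile_add_one hf
  zero_of_two_le _ _ _ h := frameProfile_eq_zero_of_two_le f h

end TestFunction

section Cells

variable {f : SL(2, ℝ) → ℂ}

/-! ### Partition of unity on the closed horocycle -/

/-- **Partition of unity** `f(g) = ∑_{(c,d)=1} f(g) χ₀,(c,d)(g·i)/E₀(g·i)` (`∑ χ₀,v = E₀ ≠ 0`).
[folklore] -/
theorem eq_tsum_cell (f : SL(2, ℝ) → ℂ) (g : SL(2, ℝ)) :
    f g = ∑' v : coprimePairs, f g * (incEisTerm cuspCutoff v.1 ↑(g • UpperHalfPlane.I) : ℂ) /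
      incEis cuspCutoff ↑(g • UpperHalfPlane.I) := by
  set z : UpperHalfPlane := g • UpperHalfPlane.I with hz
  have hE := incEis_cuspCutoff_ne_zero z.coe_im_pos
  calc f g = f g / incEis cuspCutoff ↑z * incEis cuspCutoff ↑z := by field_simp
    _ = f g / incEis cuspCutoff ↑z * ∑' v : coprimePairs, (incEisTerm cuspCutoff v.1 ↑z : ℂ) := by
        unfold incEis; rw [Complex.ofReal_tsum]
    _ = ∑' v : coprimePairs, f g * (incEisTerm cuspCutoff v.1 ↑z : ℂ) / incEis cuspCutoff ↑z := by
        rw [← tsum_mul_left]; exact tsum_congr fun v => by ring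

/-- On the closed horocycle: `f(n(u)a(y)) = ∑_{(c,d)=1} cell_{(c,d)}(u)`. [folklore] -/
theorem apply_frame_eq_tsum_frameCell (f : SL(2, ℝ) → ℂ) {y : ℝ} (hy : 0 < y) (u : ℝ) :
    f (modularHorocycleFrame u y) = ∑' v : coprimePairs, frameCell f y v.1 u := by
  have h := eq_tsum_cell f (modularHorocycleFrame u y)
  rw [modularHorocycleFrame_smul_I hy] at h
  exact h

/-- Only pairs in the box `pairBox N` contribute on the segment `|u| ≤ 1` (tree box lemma
`incEisTerm_eq_zero_of_not_mem_pairBox` with `a = 1/2`). [folklore] -/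
theorem frameCell_eq_zero_of_not_mem_pairBox (f : SL(2, ℝ) → ℂ) {y : ℝ} (hy : 0 < y) {N : ℕ}
    (hN₀ : 1 / (1 / 2 * y) ≤ N) (hN₁ : 1 / (1 / 2 * y) * 1 + Real.sqrt (y / (1 / 2)) ≤ N)
    {u : ℝ} (hu : |u| ≤ 1) {v : Fin 2 → ℤ} (hv : v ∉ pairBox N) : frameCell f y v u = 0 := by
  unfold frameCell
  have h := incEisTerm_eq_zero_of_not_mem_pairBox (a := 1 / 2) (ψ := cuspCutoff) (by norm_num)
    cuspCutoff_support hy hN₀ hN₁ (z := (u : ℂ) + y * I) (by simp) (by simp) (by simpa using hu) hv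
  rw [h]; simp

/-- The partition of unity on the segment is a finite sum over `coprimePairBox N`. [folklore] -/
theorem tsum_frameCell_eq_sum (f : SL(2, ℝ) → ℂ) {y : ℝ} (hy : 0 < y) {N : ℕ}
    (hN₀ : 1 / (1 / 2 * y) ≤ N) (hN₁ : 1 / (1 / 2 * y) * 1 + Real.sqrt (y / (1 / 2)) ≤ N)
    {u : ℝ} (hu : |u| ≤ 1) :
    ∑' v : coprimePairs, frameCell f y v.1 u = ∑ v ∈ coprimePairBox N, frameCell f y v.1 u := by
  apply tsum_eq_sum
  intro v hv
  apply frameCell_eq_zero_of_not_mem_pairBox f hy hN₀ hN₁ hu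
  classical
  simpa [coprimePairBox, Finset.mem_subtype] using hv

/-- Continuity of `u ↦ f(n(u) a(y))`. [folklore] -/
theorem IsModularFrameTestFunction.continuous_apply_frame (hf : IsModularFrameTestFunction f) {y : ℝ}
    (hy : 0 < y) : Continuous fun u : ℝ => f (modularHorocycleFrame u y) := by
  obtain ⟨F, hF, hfF⟩ := hf.1
  have e : (fun u : ℝ => f (modularHorocycleFrame u y)) = fun u : ℝ =>
      F ![![Real.sqrt y, u / Real.sqrt y], ![0, (Real.sqrt y)⁻¹]] := by
    funext u
    rw [hfF, modularHorocycleFrame_coe hy]; rfl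
  rw [e]
  refine hF.continuous.comp ?_
  refine continuous_pi fun i => continuous_pi fun j => ?_
  fin_cases i <;> fin_cases j <;> simp <;> fun_prop

/-- Continuity of the cells in `u`. [folklore] -/
theorem IsModularFrameTestFunction.continuous_frameCell (hf : IsModularFrameTestFunction f) {y : ℝ}
    (hy : 0 < y) (v : Fin 2 → ℤ) : Continuous fun u : ℝ => frameCell f y v u := by
  unfold frameCell
  have him : ∀ u : ℝ, 0 < ((u : ℂ) + y * I).im := fun u => by simp [hy]
  refine Continuous.div (Continuous.mul (hf.continuous_apply_frame hy) ?_) ?_ ?_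
  · refine Complex.continuous_ofReal.comp ?_
    by_cases hv : v = 0
    · subst hv
      have : (fun u : ℝ => incEisTerm cuspCutoff 0 ((u : ℂ) + y * I)) = fun _ => cuspCutoff 0 := by
        funext u; simp [incEisTerm]
      rw [this]; exact continuous_const
    · exact (contDiffOn_incEisTerm contDiff_cuspCutoff hv).continuousOn.comp_continuous
        (by fun_prop) fun u => him u
  · exact contDiffOn_incEis_cuspCutoff.continuousOn.comp_continuous (by fun_prop) fun u => him u
  · exact fun u => incEis_cuspCutoff_ne_zero (him u)

open scoped Classical in
/-- **Step 1 of the unfolding**: `∫₀¹ f(n(u)a(y)) du = ∑_{v ∈ pairBox N, v coprime} ∫₀¹ cell_v`.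
[folklore] -/
theorem integral_eq_boxSum (hf : IsModularFrameTestFunction f) {y : ℝ} (hy : 0 < y) {N : ℕ}
    (hN₀ : 1 / (1 / 2 * y) ≤ N) (hN₁ : 1 / (1 / 2 * y) * 1 + Real.sqrt (y / (1 / 2)) ≤ N) :
    ∫ u in (0:ℝ)..1, f (modularHorocycleFrame u y) =
      ∑ v ∈ pairBox N, if IsCoprime (v 0) (v 1) then ∫ u in (0:ℝ)..1, frameCell f y v u else 0 := by
  have hseg : ∀ u ∈ Set.uIcc (0:ℝ) 1, f (modularHorocycleFrame u y) =
      ∑ v ∈ coprimePairBox N, frameCell f y v.1 u := by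
    intro u hu
    rw [Set.uIcc_of_le zero_le_one] at hu
    rw [apply_frame_eq_tsum_frameCell f hy u]
    exact tsum_frameCell_eq_sum f hy hN₀ hN₁ (by rw [abs_le]; constructor <;> linarith [hu.1, hu.2])
  rw [intervalIntegral.integral_congr hseg]
  have hint : ∀ v ∈ coprimePairBox N,
      IntervalIntegrable (fun u : ℝ => frameCell f y v.1 u) volume 0 1 :=
    fun v _ => (hf.continuous_frameCell hy v.1).intervalIntegrable _ _
  rw [intervalIntegral.integral_finsetSum hint]
  unfold coprimePairBox
  rw [Finset.sum_subtype_eq_sum_filter (f := fun v : Fin 2 → ℤ => ∫ u in (0:ℝ)..1, frameCell f y v u),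
    Finset.sum_filter]
  refine Finset.sum_congr rfl fun v _ => ?_
  simp only [coprimePairs, EisensteinSeries.mem_gammaSet_one]

/-! ### Rows -/

/-- `v = (v₀, v₁)`. [folklore] -/
theorem vec_two_eta (v : Fin 2 → ℤ) : ![v 0, v 1] = v := by
  funext i; fin_cases i <;> rfl

/-- The row `c = 0` vanishes for `y ≤ 1/2`: only `d = ±1` are coprime to `0`, and
`χ₀(y/1) = 0`. [folklore] -/
theorem row_zero_eq_zero (f : SL(2, ℝ) → ℂ) {y : ℝ} (hy2 : y ≤ 1 / 2) (N : ℕ) :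
    (∑ d ∈ Finset.Icc (-(N : ℤ)) N, if IsCoprime (0 : ℤ) d then
        ∫ u in (0:ℝ)..1, frameCell f y ![0, d] u else 0) = 0 := by
  refine Finset.sum_eq_zero fun d _ => ?_
  split_ifs with h
  · have hd : d = 1 ∨ d = -1 := by rwa [isCoprime_zero_left, Int.isUnit_iff] at h
    have h0 : ∀ u : ℝ, incEisTerm cuspCutoff ![0, d] ((u : ℂ) + y * I) = 0 := fun u => by
      unfold incEisTerm
      rcases hd with rfl | rfl <;> simp [cuspCutoff_of_le hy2]
    simp [frameCell, h0]
  · rfl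

/-- Cell symmetry `cell_{-v} = cell_v`. [folklore] -/
theorem frameCell_neg (f : SL(2, ℝ) → ℂ) (y : ℝ) (v : Fin 2 → ℤ) (u : ℝ) :
    frameCell f y (-v) u = frameCell f y v u := by
  unfold frameCell incEisTerm
  have : Complex.normSq ((((-v) 0 : ℤ) : ℂ) * ((u : ℂ) + y * I) + (((-v) 1 : ℤ) : ℂ)) =
      Complex.normSq (((v 0 : ℤ) : ℂ) * ((u : ℂ) + y * I) + ((v 1 : ℤ) : ℂ)) := by
    rw [← Complex.normSq_neg]
    congr 1
    simp only [Pi.neg_apply, Int.cast_neg]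
    ring
  rw [this]

/-- Row symmetry: the rows `-c` and `c` agree (reindex `d ↦ -d`). [folklore] -/
theorem row_neg (f : SL(2, ℝ) → ℂ) (y : ℝ) (N : ℕ) (c : ℤ) :
    (∑ d ∈ Finset.Icc (-(N : ℤ)) N, if IsCoprime (-c) d then
        ∫ u in (0:ℝ)..1, frameCell f y ![-c, d] u else 0) =
      ∑ d ∈ Finset.Icc (-(N : ℤ)) N, if IsCoprime c d then
        ∫ u in (0:ℝ)..1, frameCell f y ![c, d] u else 0 := by
  refine Finset.sum_equiv (Equiv.neg ℤ) (fun d => ?_) (fun d _ => ?_)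
  · simp only [Finset.mem_Icc, Equiv.neg_apply]; omega
  · simp only [Equiv.neg_apply, IsCoprime.neg_left_iff, IsCoprime.neg_right_iff]
    split_ifs with hcd
    · refine intervalIntegral.integral_congr fun u _ => ?_
      have e : (![-c, d] : Fin 2 → ℤ) = -![c, -d] := by
        funext i; fin_cases i <;> simp
      simp only [e, frameCell_neg]
    · rfl

/-- **Shift of cells along a row**: `cell_{(c, cq + r)}(u) = cell_{(c, r)}(u + q)` (invariance of
`f` and of `E₀` under `T^q`, and `c(u + q + iy) + r = c(u + iy) + (cq + r)`). [folklore] -/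
theorem IsModularFrameTestFunction.frameCell_shift (hf : IsModularFrameTestFunction f) {y : ℝ}
    (hy : 0 < y) (c r q : ℤ) (u : ℝ) :
    frameCell f y ![c, c * q + r] u = frameCell f y ![c, r] (u + q) := by
  unfold frameCell incEisTerm
  have h1 : f (modularHorocycleFrame (u + q) y) = f (modularHorocycleFrame u y) :=
    hf.apply_frame_add_int hy u q
  have h2 : incEis cuspCutoff (((u + q : ℝ) : ℂ) + y * I) = incEis cuspCutoff ((u : ℂ) + y * I) := by
    have hz : 0 < ((u : ℂ) + y * I).im := by simp [hy]
    have := incEis_smul cuspCutoff (ModularGroup.T ^ q) ⟨(u : ℂ) + y * I, hz⟩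
    rw [coe_T_zpow_smul] at this
    rw [← this]
    congr 1; push_cast; ring
  have e1 : (((u + q : ℝ) : ℂ) + y * I).im = ((u : ℂ) + y * I).im := by simp
  have e2 : (c : ℂ) * (((u + q : ℝ) : ℂ) + y * I) + (r : ℂ) =
      (c : ℂ) * ((u : ℂ) + y * I) + ((c * q + r : ℤ) : ℂ) := by push_cast; ring
  simp only [Matrix.cons_val_zero, Matrix.cons_val_one, h1, h2, e1, e2]

/-- Support of a cell along a row: `cell_{(c,r)}(u) ≠ 0` (`c ≥ 1`, `0 ≤ r < c`, `y < 1`) forces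
`|u| < 3` (`(cu + r)² ≤ 2y`). [folklore] -/
theorem abs_lt_three_of_frameCell_ne_zero (f : SL(2, ℝ) → ℂ) {y : ℝ} (hy : 0 < y) (hy1 : y < 1)
    {c : ℕ} (hc : 1 ≤ c) {r : ℕ} (hr : r < c) {u : ℝ}
    (h : frameCell f y ![(c : ℤ), (r : ℤ)] u ≠ 0) : |u| < 3 := by
  have hne : incEisTerm cuspCutoff ![(c : ℤ), (r : ℤ)] ((u : ℂ) + y * I) ≠ 0 := by
    intro h0; apply h; simp [frameCell, h0]
  have h2 := (sq_le_of_incEisTerm_ne_zero (a := 1 / 2) (by norm_num) cuspCutoff_support hne).2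
  simp only [Matrix.cons_val_zero, Matrix.cons_val_one, Int.cast_natCast,
    add_re, ofReal_re, mul_re, I_re, mul_zero, ofReal_im, I_im, mul_one, sub_self, add_zero,
    add_im, mul_im, zero_add] at h2
  have hcR : (1 : ℝ) ≤ c := by exact_mod_cast hc
  have hrR : (0 : ℝ) ≤ r := by positivity
  have hrc : (r : ℝ) + 1 ≤ c := by exact_mod_cast hr
  have hsq : ((c : ℝ) * u + r) ^ 2 < 2 := by
    have : y / (1 / 2) = 2 * y := by ring
    rw [this] at h2; nlinarith
  have hlt : |(c : ℝ) * u + r| < 3 / 2 := by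
    rw [← Real.sqrt_sq_eq_abs]
    calc Real.sqrt (((c : ℝ) * u + r) ^ 2) < Real.sqrt 2 := Real.sqrt_lt_sqrt (sq_nonneg _) hsq
      _ < 3 / 2 := by
        rw [Real.sqrt_lt' (by norm_num)]; norm_num
  rw [abs_lt] at hlt ⊢
  constructor <;> nlinarith [hlt.1, hlt.2]

/-- **The row `c ≥ 1`.** Regroup `d = c(k - M) + r` (`0 ≤ r < c`): the `k`-sum tiles `ℝ`, giving
`∑_{r mod c, (r,c)=1} ∫_ℝ cell_{(c,r)}`. [folklore] -/
theorem IsModularFrameTestFunction.row_eq_sum_residues (hf : IsModularFrameTestFunction f) {y : ℝ}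
    (hy : 0 < y) (hy1 : y < 1) {N : ℕ} (hN₀ : 1 / (1 / 2 * y) ≤ N)
    (hN₁ : 1 / (1 / 2 * y) * 1 + Real.sqrt (y / (1 / 2)) ≤ N) {c : ℕ} (hc : 1 ≤ c) :
    (∑ d ∈ Finset.Icc (-(N : ℤ)) N, if IsCoprime (c : ℤ) d then
        ∫ u in (0:ℝ)..1, frameCell f y ![(c : ℤ), d] u else 0) =
      ∑ r ∈ (Finset.range c).filter (fun r => Nat.Coprime c r),
        ∫ u : ℝ, frameCell f y ![(c : ℤ), (r : ℤ)] u := by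
  have hc0 : (c : ℤ) ≠ 0 := by exact_mod_cast (show c ≠ 0 by omega)
  have hc0' : (0 : ℤ) < c := by exact_mod_cast hc
  have hN2 : (2 : ℝ) < N := by
    have h1 : 1 / (1 / 2 * y) = 2 / y := by field_simp
    rw [h1] at hN₀
    have : (2 : ℝ) < 2 / y := by rw [lt_div_iff₀ hy]; nlinarith
    linarith
  set M : ℕ := N + 1 with hM
  have hM3 : (3 : ℝ) ≤ M := by
    have : (2 : ℕ) < N := by exact_mod_cast hN2
    have : (3 : ℕ) ≤ M := by omega
    exact_mod_cast this
  -- the summand as a function of `d`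
  set G : ℤ → ℂ := fun d => if IsCoprime (c : ℤ) d then
    ∫ u in (0:ℝ)..1, frameCell f y ![(c : ℤ), d] u else 0 with hG
  -- `G` vanishes for `|d| > N` (box lemma)
  have hG0 : ∀ d : ℤ, (N : ℤ) < |d| → G d = 0 := by
    intro d hd
    simp only [hG]
    split_ifs with hcop
    · have : ∀ u ∈ Set.uIcc (0 : ℝ) 1, frameCell f y ![(c : ℤ), d] u = 0 := by
        intro u hu
        rw [Set.uIcc_of_le zero_le_one] at hu
        have hv : (![(c : ℤ), d] : Fin 2 → ℤ) ∉ pairBox N := by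
          rw [mem_pairBox]; push Not; exact ⟨1, by simpa using hd⟩
        exact frameCell_eq_zero_of_not_mem_pairBox f hy hN₀ hN₁
          (by rw [abs_le]; constructor <;> linarith [hu.1, hu.2]) hv
      rw [intervalIntegral.integral_congr this]
      simp
    · rfl
  -- reindex by `d = c (k - M) + r`
  set idx : ℕ × ℕ → ℤ := fun p => (c : ℤ) * ((p.1 : ℤ) - M) + p.2 with hidx
  set P : Finset (ℕ × ℕ) := Finset.range (M + M + 1) ×ˢ Finset.range c with hP
  have hinj : Set.InjOn idx ↑P := by
    rintro ⟨k, r⟩ hkr ⟨k', r'⟩ hkr' heq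
    simp only [hP, Finset.coe_product, Set.mem_prod, Finset.mem_coe, Finset.mem_range] at hkr hkr'
    simp only [hidx] at heq
    have h1 := (Int.ediv_emod_unique (a := idx (k, r)) (b := (c : ℤ)) (r := (r : ℤ))
      (q := (k : ℤ) - M) hc0').mpr ⟨by simp only [hidx]; ring, by omega, by omega⟩
    have h2 := (Int.ediv_emod_unique (a := idx (k', r')) (b := (c : ℤ)) (r := (r' : ℤ))
      (q := (k' : ℤ) - M) hc0').mpr ⟨by simp only [hidx]; ring, by omega, by omega⟩
    have hkk : (k : ℤ) - M = k' - M := by rw [← h1.1, ← h2.1]; simp only [hidx, heq]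
    have hrr : (r : ℤ) = r' := by rw [← h1.2, ← h2.2]; simp only [hidx, heq]
    simp only [Prod.mk.injEq]; omega
  have hcover : Finset.Icc (-(N : ℤ)) N ⊆ P.image idx := by
    intro d hd
    rw [Finset.mem_Icc] at hd
    rw [Finset.mem_image]
    have hdec := (Int.ediv_emod_unique hc0' (a := d) (q := d / c) (r := d % c)).mp ⟨rfl, rfl⟩
    obtain ⟨hqr, hr0, hrc⟩ := hdec
    have hq1 : -(N : ℤ) ≤ d / c := by nlinarith
    have hq2 : d / c ≤ N := by nlinarith
    refine ⟨((d / c + M).toNat, (d % c).toNat), ?_, ?_⟩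
    · simp only [hP, Finset.mem_product, Finset.mem_range]; omega
    · simp only [hidx]
      rw [Int.toNat_of_nonneg (by omega), Int.toNat_of_nonneg hr0]
      linarith
  have step1 : ∑ d ∈ Finset.Icc (-(N : ℤ)) N, G d = ∑ p ∈ P, G (idx p) := by
    rw [← Finset.sum_image hinj]
    apply Finset.sum_subset hcover
    intro d hd hd'
    apply hG0
    rw [Finset.mem_Icc] at hd'
    rcases le_or_gt 0 d with h | h
    · rw [abs_of_nonneg h]; omega
    · rw [abs_of_neg h]; omega
  -- evaluate the summand at `idx (k, r)`
  have step2 : ∀ k r : ℕ, G (idx (k, r)) = if IsCoprime (c : ℤ) r then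
      ∫ u in ((k : ℝ) + (-(M : ℝ)))..((k : ℝ) + (-(M : ℝ)) + 1), frameCell f y ![(c : ℤ), (r : ℤ)] u
      else 0 := by
    intro k r
    simp only [hG, hidx]
    have hiff : IsCoprime (c : ℤ) ((c : ℤ) * ((k : ℤ) - M) + r) ↔ IsCoprime (c : ℤ) (r : ℤ) := by
      rw [add_comm, IsCoprime.add_mul_left_right_iff]
    by_cases hcop : IsCoprime (c : ℤ) (r : ℤ)
    · rw [if_pos (hiff.mpr hcop), if_pos hcop]
      have hshift : ∀ u : ℝ, frameCell f y ![(c : ℤ), (c : ℤ) * ((k : ℤ) - M) + r] u =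
          frameCell f y ![(c : ℤ), (r : ℤ)] (u + (((k : ℤ) - M : ℤ) : ℝ)) := fun u =>
        hf.frameCell_shift hy c r ((k : ℤ) - M) u
      simp_rw [hshift]
      rw [intervalIntegral.integral_comp_add_right (fun u => frameCell f y ![(c : ℤ), (r : ℤ)] u)]
      congr 1 <;> push_cast <;> ring
    · rw [if_neg (fun h => hcop (hiff.mp h)), if_neg hcop]
  rw [step1, hP, Finset.sum_product_right]
  simp_rw [step2]
  -- the `k`-sum tiles `ℝ`
  have step3 : ∀ r ∈ Finset.range c,
      ∑ k ∈ Finset.range (M + M + 1),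
        ∫ u in ((k : ℝ) + (-(M : ℝ)))..((k : ℝ) + (-(M : ℝ)) + 1), frameCell f y ![(c : ℤ), (r : ℤ)] u =
      ∫ u, frameCell f y ![(c : ℤ), (r : ℤ)] u := by
    intro r hr
    rw [Finset.mem_range] at hr
    apply HorocycleUnfolding.sum_integral_unit_intervals' (hf.continuous_frameCell hy _)
    intro u hu
    have hu' := abs_lt.mp (abs_lt_three_of_frameCell_ne_zero f hy hy1 hc hr hu)
    constructor
    · linarith [hu'.1]
    · push_cast; linarith [hu'.2]
  have step4 : ∀ r ∈ Finset.range c,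
      (∑ k ∈ Finset.range (M + M + 1), if IsCoprime (c : ℤ) r then
        ∫ u in ((k : ℝ) + (-(M : ℝ)))..((k : ℝ) + (-(M : ℝ)) + 1), frameCell f y ![(c : ℤ), (r : ℤ)] u
        else 0) = if IsCoprime (c : ℤ) r then ∫ u, frameCell f y ![(c : ℤ), (r : ℤ)] u else 0 := by
    intro r hr
    split_ifs with h
    · exact step3 r hr
    · simp
  rw [Finset.sum_congr rfl step4, ← Finset.sum_filter]
  have hfilter : (Finset.range c).filter (fun r : ℕ => IsCoprime (c : ℤ) (r : ℤ)) =
      (Finset.range c).filter (fun r => Nat.Coprime c r) :=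
    Finset.filter_congr fun r _ => Nat.isCoprime_iff_coprime
  rw [hfilter]

end Cells

section RowIntegral

variable {f : SL(2, ℝ) → ℂ}

/-! ### The row integral is an arc transform of the profile -/

/-- **Cell identity.** For `γ ∈ SL(2,ℤ)` with bottom row `v` and `g ∈ SL(2,ℝ)`:
`f(g) χ₀,v(g·i)/E₀(g·i) = p(coords(γ g))`, `p` the profile of `f` (invariance of `f` and `E₀`,
`im (γ·z) = im z/|cz+d|²`, and `γ g = n(x) s(c', d')` in frame coordinates). [folklore] -/
theorem IsModularFrameTestFunction.cell_eq_frameProfile (hf : IsModularFrameTestFunction f)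
    (γ : SL(2, ℤ)) (g : SL(2, ℝ)) :
    f g * (incEisTerm cuspCutoff ((γ : Matrix (Fin 2) (Fin 2) ℤ) 1) ↑(g • UpperHalfPlane.I) : ℂ) /
        incEis cuspCutoff ↑(g • UpperHalfPlane.I) =
      frameProfile f (xOf (((γ : SL(2, ℝ)) * g : SL(2, ℝ)) : Matrix (Fin 2) (Fin 2) ℝ),
        ((γ : SL(2, ℝ)) * g : SL(2, ℝ)) 1 0, ((γ : SL(2, ℝ)) * g : SL(2, ℝ)) 1 1) := by
  set g' : SL(2, ℝ) := (γ : SL(2, ℝ)) * g with hg'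
  set z : UpperHalfPlane := g • UpperHalfPlane.I with hz
  have hpt : (⟨xOf g', 1 / ((g' 1 0) ^ 2 + (g' 1 1) ^ 2)⟩ : ℂ) = ↑(γ • z) := by
    rw [hz, ← coe_int_mul_smul, ← hg', coe_smul_I_eq g']
    unfold Literature.MeasureTheory.Group.yOf
    rw [g'.det_coe]
  have him : 1 / ((g' 1 0) ^ 2 + (g' 1 1) ^ 2) =
      z.im / Complex.normSq (((γ 1 0 : ℤ) : ℂ) * (z : ℂ) + ((γ 1 1 : ℤ) : ℂ)) := by
    have h : (1 / ((g' 1 0) ^ 2 + (g' 1 1) ^ 2) : ℝ) = (↑(γ • z) : ℂ).im := congrArg Complex.im hpt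
    rw [UpperHalfPlane.coe_im, HorocycleUnfolding.im_smul_eq] at h
    exact h
  rw [frameProfile_apply, frameOf_xOf_eq g', hpt, incEis_smul cuspCutoff γ z, him, hg', hf.2.1 γ g]
  unfold incEisTerm
  rw [UpperHalfPlane.coe_im]

/-- The entries of `γ · n(u) a(y)` for `γ ∈ SL(2,ℤ)`. [folklore] -/
theorem coe_int_mul_modularHorocycleFrame (γ : SL(2, ℤ)) {y : ℝ} (hy : 0 < y) (u : ℝ) :
    ((((γ : SL(2, ℝ)) * modularHorocycleFrame u y : SL(2, ℝ)) : Matrix (Fin 2) (Fin 2) ℝ)) =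
      !![(γ 0 0 : ℝ) * Real.sqrt y, ((γ 0 0 : ℝ) * u + γ 0 1) / Real.sqrt y;
         (γ 1 0 : ℝ) * Real.sqrt y, ((γ 1 0 : ℝ) * u + γ 1 1) / Real.sqrt y] := by
  rw [Matrix.SpecialLinearGroup.coe_mul, modularHorocycleFrame_coe hy,
    Matrix.SpecialLinearGroup.coe_matrix_coe]
  have hs : Real.sqrt y ≠ 0 := (Real.sqrt_pos.2 hy).ne'
  ext i j
  fin_cases i <;> fin_cases j <;> simp [Matrix.mul_apply, Fin.sum_univ_two] <;> ring

/-- The algebra of the substitution `u = s² t - r/c` (`s = √y`): `re` of the arc point. [folklore] -/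
theorem xOf_arc_aux {A B c r s t : ℝ} (hdet : A * r - B * c = 1) (hc : c ≠ 0) (hs : s ≠ 0) :
    (A * s * (c * s) + (A * (s ^ 2 * t - r / c) + B) / s * ((c * (s ^ 2 * t - r / c) + r) / s)) /
      ((c * s) ^ 2 + ((c * (s ^ 2 * t - r / c) + r) / s) ^ 2) =
      A / c - t / (c ^ 2 * s ^ 2 * (1 + t ^ 2)) := by
  have ht : 1 + t ^ 2 ≠ 0 := by positivity
  have hB : B = (A * r - 1) / c := by field_simp; linarith
  subst hB
  field_simp
  ring

/-- An affine substitution in a Lebesgue integral: `∫ g = y ∫ g(yt - s) dt` (`y > 0`). [folklore] -/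
theorem integral_comp_affine (g : ℝ → ℂ) {y : ℝ} (hy : 0 < y) (s : ℝ) :
    ∫ u : ℝ, g u = (y : ℂ) * ∫ t : ℝ, g (y * t - s) := by
  have h1 : ∫ t : ℝ, g (y * t - s) = |y⁻¹| • ∫ u : ℝ, g (u - s) :=
    Measure.integral_comp_mul_left (fun u => g (u - s)) y
  have h2 : ∫ u : ℝ, g (u - s) = ∫ u, g u := integral_sub_right_eq_self g s
  rw [h1, h2, abs_of_pos (inv_pos.2 hy), Complex.real_smul, ← mul_assoc, ← Complex.ofReal_mul,
    mul_inv_cancel₀ hy.ne', Complex.ofReal_one, one_mul]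

/-- **The row integral as an arc transform of the profile**: for `c ≥ 1`, `(c, r) = 1`,
`∫_ℝ cell_{(c,r)}(u) du = y Ψ_p(c²y, r̄/c)` with `r̄ = gcdA r c ≡ r⁻¹ (mod c)`
(`γ_{c,r} n(u) a(y) = (A√y, (Au+B)/√y; c√y, (cu+r)/√y)`, `u = yt - r/c`). [folklore] -/
theorem IsModularFrameTestFunction.integral_frameCell_eq (hf : IsModularFrameTestFunction f) {y : ℝ}
    (hy : 0 < y) {c : ℕ} (hc : 1 ≤ c) {r : ℕ} (hcop : Nat.Coprime c r) :
    ∫ u : ℝ, frameCell f y ![(c : ℤ), (r : ℤ)] u =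
      (y : ℂ) * frameArcTransform (frameProfile f) ((c : ℝ) ^ 2 * y) ((Int.gcdA r c : ℝ) / c) := by
  have hcopZ : IsCoprime ((c : ℕ) : ℤ) ((r : ℕ) : ℤ) := Nat.isCoprime_iff_coprime.mpr hcop
  have hbez := HorocycleUnfolding.gcdA_mul_add_gcdB_mul hcopZ
  set A : ℤ := Int.gcdA r c with hA
  set B : ℤ := -Int.gcdB r c with hB
  have hdet : A * r - B * c = 1 := by rw [hB]; linarith [hbez]
  let γ : SL(2, ℤ) := ⟨!![A, B; c, r], by rw [Matrix.det_fin_two_of]; linarith [hdet]⟩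
  have hγ1 : ((γ : Matrix (Fin 2) (Fin 2) ℤ) 1) = ![(c : ℤ), (r : ℤ)] := by
    funext j; fin_cases j <;> rfl
  have hcR : (c : ℝ) ≠ 0 := by exact_mod_cast (show c ≠ 0 by omega)
  have hcR0 : (0 : ℝ) ≤ c := by positivity
  have hs : Real.sqrt y ≠ 0 := (Real.sqrt_pos.2 hy).ne'
  have hsq : Real.sqrt y ^ 2 = y := Real.sq_sqrt hy.le
  have hdetR : (A : ℝ) * r - B * c = 1 := by exact_mod_cast hdet
  -- pointwise cell identity on the horocycle
  have hcell : ∀ u : ℝ, frameCell f y ![(c : ℤ), (r : ℤ)] u =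
      frameProfile f (xOf (((γ : SL(2, ℝ)) * modularHorocycleFrame u y : SL(2, ℝ)) : Matrix (Fin 2) (Fin 2) ℝ),
        ((γ : SL(2, ℝ)) * modularHorocycleFrame u y : SL(2, ℝ)) 1 0,
        ((γ : SL(2, ℝ)) * modularHorocycleFrame u y : SL(2, ℝ)) 1 1) := fun u => by
    have h := hf.cell_eq_frameProfile γ (modularHorocycleFrame u y)
    rw [modularHorocycleFrame_smul_I hy, hγ1] at h
    exact h
  -- the coordinates of `γ n(u) a(y)` at `u = y t - r/c`
  have hcoords : ∀ t : ℝ,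
      (xOf (((γ : SL(2, ℝ)) * modularHorocycleFrame (y * t - r / c) y : SL(2, ℝ)) : Matrix (Fin 2) (Fin 2) ℝ),
        ((γ : SL(2, ℝ)) * modularHorocycleFrame (y * t - r / c) y : SL(2, ℝ)) 1 0,
        ((γ : SL(2, ℝ)) * modularHorocycleFrame (y * t - r / c) y : SL(2, ℝ)) 1 1) =
      (((A : ℝ) / c - t / ((c : ℝ) ^ 2 * y * (1 + t ^ 2)) : ℝ), Real.sqrt ((c : ℝ) ^ 2 * y),
        Real.sqrt ((c : ℝ) ^ 2 * y) * t) := by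
    intro t
    have hent := coe_int_mul_modularHorocycleFrame γ hy (y * t - r / c)
    have e10 : ((γ : SL(2, ℝ)) * modularHorocycleFrame (y * t - r / c) y : SL(2, ℝ)) 1 0 =
        (c : ℝ) * Real.sqrt y := by
      have := congrFun (congrFun hent 1) 0
      simpa [γ] using this
    have e11 : ((γ : SL(2, ℝ)) * modularHorocycleFrame (y * t - r / c) y : SL(2, ℝ)) 1 1 =
        ((c : ℝ) * (y * t - r / c) + r) / Real.sqrt y := by
      have := congrFun (congrFun hent 1) 1
      simpa [γ] using this
    have ex : xOf (((γ : SL(2, ℝ)) * modularHorocycleFrame (y * t - r / c) y : SL(2, ℝ)) :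
        Matrix (Fin 2) (Fin 2) ℝ) = (A : ℝ) / c - t / ((c : ℝ) ^ 2 * y * (1 + t ^ 2)) := by
      unfold Literature.MeasureTheory.Group.xOf
      rw [hent]
      simp only [Matrix.of_apply, Matrix.cons_val', Matrix.cons_val_zero, Matrix.cons_val_one,
        Matrix.empty_val', Matrix.cons_val_fin_one, γ]
      have h := xOf_arc_aux (t := t) hdetR hcR hs
      rw [hsq] at h
      push_cast
      exact h
    have hsqrt : Real.sqrt ((c : ℝ) ^ 2 * y) = (c : ℝ) * Real.sqrt y := by
      rw [Real.sqrt_mul (sq_nonneg _), Real.sqrt_sq hcR0]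
    rw [ex, e10, e11, hsqrt]
    congr 2
    have e : (c : ℝ) * (y * t - r / c) + r = c * y * t := by field_simp; ring
    rw [e, div_eq_iff hs]
    have hmul : Real.sqrt y * Real.sqrt y = y := Real.mul_self_sqrt hy.le
    linear_combination (-((c : ℝ) * t)) * hmul
  -- substitute
  simp_rw [hcell]
  rw [integral_comp_affine (fun u => frameProfile f
      (xOf (((γ : SL(2, ℝ)) * modularHorocycleFrame u y : SL(2, ℝ)) : Matrix (Fin 2) (Fin 2) ℝ),
      ((γ : SL(2, ℝ)) * modularHorocycleFrame u y : SL(2, ℝ)) 1 0,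
      ((γ : SL(2, ℝ)) * modularHorocycleFrame u y : SL(2, ℝ)) 1 1)) hy ((r : ℝ) / c)]
  congr 1
  unfold frameArcTransform
  refine integral_congr_ae (ae_of_all _ fun t => ?_)
  simp only []
  rw [hcoords t]

/-- The arc transforms of the profile along a row only depend on `r⁻¹ (mod c)`:
`∑_{(r,c)=1} Ψ_p(c²y, gcdA r c/c) = ∑_{(a,c)=1} Ψ_p(c²y, a/c)` (tree lemma
`HorocycleUnfolding.sum_coprime_gcdA_eq`). [folklore] -/
theorem sum_frameArcTransform_gcdA {p : ℝ × ℝ × ℝ → ℂ} (hp : IsFrameStripFun p) (w : ℝ) {c : ℕ}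
    (hc : 1 ≤ c) :
    ∑ r ∈ (Finset.range c).filter (fun r => Nat.Coprime c r),
        frameArcTransform p w ((Int.gcdA r c : ℝ) / c) =
      ∑ r ∈ (Finset.range c).filter (fun r => Nat.Coprime c r), frameArcTransform p w ((r : ℝ) / c) :=
  HorocycleUnfolding.sum_coprime_gcdA_eq (h := fun θ => frameArcTransform p w θ)
    (fun θ => hp.frameArcTransform_add_one w θ) hc

end RowIntegral

section Main

variable {f : SL(2, ℝ) → ℂ}

open scoped Classical in
/-- **Unfolding of the closed horocycle on the frame bundle** (frame version of the tree's
`HorocycleUnfolding_holds`; Iwaniec, *Spectral methods*, §2.4 (2.21), §3.4): for a test function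
`f` on `SL(2,ℤ)\SL(2,ℝ)`, `0 < y < 1/2` and `N ≥ √(2/y)`,
`∫₀¹ f(n(x)a(y)) dx = 2y ∑_{c=1}^{N} ∑_{a mod c, (a,c)=1} Ψ_p(c²y, a/c)`, `p` the profile of `f`.
[cite: Iwaniec2002, §2.4 Thm. 2.7 (2.21); §3.4 p. 59] -/
theorem IsModularFrameTestFunction.frameUnfolding (hf : IsModularFrameTestFunction f) {y : ℝ}
    (hy : 0 < y) (hy2 : y < 1 / 2) {N : ℕ} (hN : Real.sqrt (2 / y) ≤ N) :
    ∫ x in (0:ℝ)..1, f (modularHorocycleFrame x y) =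
      2 * (y : ℂ) * ∑ c ∈ Finset.Ioc 0 N, ∑ a ∈ (Finset.range c).filter (fun a => Nat.Coprime c a),
        frameArcTransform (frameProfile f) ((c : ℝ) ^ 2 * y) ((a : ℝ) / c) := by
  have hy1 : y < 1 := by linarith
  have hp := hf.isFrameStripFun_frameProfile
  -- a box large enough and containing `N`
  set Nb : ℕ := ⌈1 / (1 / 2 * y) * 1 + Real.sqrt (y / (1 / 2))⌉₊ + N with hNb
  have hceil : 1 / (1 / 2 * y) * 1 + Real.sqrt (y / (1 / 2)) ≤ Nb := by
    refine (Nat.le_ceil _).trans ?_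
    simp [hNb]
  have hN₁ : 1 / (1 / 2 * y) * 1 + Real.sqrt (y / (1 / 2)) ≤ Nb := hceil
  have hN₀ : 1 / (1 / 2 * y) ≤ Nb := le_trans (by simp [Real.sqrt_nonneg]) hceil
  have hNNb : N ≤ Nb := by omega
  -- the rows `N < c ≤ Nb` of the right-hand side vanish (`c² y > 2`)
  have hvan : ∀ c ∈ Finset.Ioc 0 Nb, c ∉ Finset.Ioc 0 N →
      ∑ a ∈ (Finset.range c).filter (fun a => Nat.Coprime c a),
        frameArcTransform (frameProfile f) ((c : ℝ) ^ 2 * y) ((a : ℝ) / c) = 0 := by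
    intro c hc hcN
    rw [Finset.mem_Ioc] at hc hcN
    have hNc : N < c := by
      by_contra h; exact hcN ⟨hc.1, not_lt.mp h⟩
    have hc2 : 2 ≤ (c : ℝ) ^ 2 * y := by
      have h3 : Real.sqrt (2 / y) < c := lt_of_le_of_lt hN (by exact_mod_cast hNc)
      rw [Real.sqrt_lt' (by exact_mod_cast (lt_of_le_of_lt (Nat.zero_le _) hNc))] at h3
      rw [div_lt_iff₀ hy] at h3
      linarith
    exact Finset.sum_eq_zero fun a _ => hp.frameArcTransform_eq_zero_of_two_le hc2 _
  rw [Finset.sum_subset (Finset.Ioc_subset_Ioc_right hNNb) hvan]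
  -- Step 1: box sum, rows
  rw [integral_eq_boxSum hf hy hN₀ hN₁]
  have e1 : ∑ v ∈ pairBox Nb, (if IsCoprime (v 0) (v 1) then ∫ u in (0:ℝ)..1, frameCell f y v u else 0) =
      ∑ v ∈ pairBox Nb, (fun c d : ℤ => if IsCoprime c d then
        ∫ u in (0:ℝ)..1, frameCell f y ![c, d] u else 0) (v 0) (v 1) := by
    refine Finset.sum_congr rfl fun v _ => ?_
    simp only [vec_two_eta]
  rw [e1, HorocycleUnfolding.sum_pairBox_eq' Nb (fun c d : ℤ => if IsCoprime c d then
    ∫ u in (0:ℝ)..1, frameCell f y ![c, d] u else 0)]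
  rw [HorocycleUnfolding.sum_Icc_symm' (h := fun c : ℤ => ∑ d ∈ Finset.Icc (-(Nb : ℤ)) Nb,
    if IsCoprime c d then ∫ u in (0:ℝ)..1, frameCell f y ![c, d] u else 0)
    (fun c => row_neg f y Nb c) Nb]
  rw [row_zero_eq_zero f hy2.le Nb, zero_add, HorocycleZeroMode.sum_Ioc_zero_eq_sum_range,
    Finset.mul_sum, Finset.mul_sum]
  refine Finset.sum_congr rfl fun k _ => ?_
  -- Step 2: the row `c = k + 1`
  have e2 : ((k : ℤ) + 1) = ((k + 1 : ℕ) : ℤ) := by push_cast; ring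
  rw [e2, hf.row_eq_sum_residues hy hy1 hN₀ hN₁ (c := k + 1) (by omega)]
  -- Step 3: row integrals are arc transforms, and `r ↦ r⁻¹ (mod c)`
  have e3 : ∑ r ∈ (Finset.range (k + 1)).filter (fun r => Nat.Coprime (k + 1) r),
      ∫ u : ℝ, frameCell f y ![((k + 1 : ℕ) : ℤ), (r : ℤ)] u =
      (y : ℂ) * ∑ r ∈ (Finset.range (k + 1)).filter (fun r => Nat.Coprime (k + 1) r),
        frameArcTransform (frameProfile f) (((k + 1 : ℕ) : ℝ) ^ 2 * y) ((Int.gcdA r (k + 1 : ℕ) : ℝ) / (k + 1 : ℕ)) := by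
    rw [Finset.mul_sum]
    refine Finset.sum_congr rfl fun r hr => ?_
    rw [Finset.mem_filter] at hr
    exact hf.integral_frameCell_eq hy (by omega) hr.2
  rw [e3, sum_frameArcTransform_gcdA hp _ (by omega)]
  ring

end Main




end Literature.Dynamics.Homogeneous

end
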